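import Summits.Langlands.Langlands.Theses.OrdinaryPrimeTransport
import Literature.NumberTheory.Automorphic.PotentialAutomorphyGL2OrdinaryWeightTwo
import Literature.FieldTheory.AlgClosed.PadicAlgClEquivComplex
import HarnessLib

/-!
# Line `OrdinaryPotentialAutomorphyEveryWeight` — G4 ladder-down rung (generation 36) on the crux
# `ReciprocityUpToIrreducibility` (item stmt-Langlands-14328; routes IrreducibilityBySelfDuality,
# OrdinaryPrimeTransport)

TOP `E` = `Summit.Langlands.Langlands.Theses.OrdinaryPrimeTransport.ReciprocityUpToIrreducibility` (the
`Iff.rfl`-equal copy of `…Theses.IrreducibilityBySelfDuality.ReciprocityUpToIrreducibility`, item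
stmt-Langlands-14328 shared by both routes; `Langlands ↔ E` landed:
`Theorems.IrreducibleOffSector.langlands_iff_reciprocityUpToIrreducibility_of_JS`).

DIAL (in `E`'s own language, clause (B) Galois → automorphic, `n = 2`, `F` totally real): the
HODGE–TATE WEIGHT `k` in Thorne's RESIDUALLY-UNRESTRICTED potential modularity theorem (every prime `p`,
NO hypothesis on `ρ̄`) — the tree's named fact
`Literature.NumberTheory.Automorphic.Thorne2026_potentialAutomorphy_GL2_potCrystallineOrdinary`
(J. A. Thorne, *Towards the Fontaine–Mazur conjecture for `GL₂`*, arXiv:2608.07186, Theorem B), whose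
local hypothesis at `v ∣ p` is `FramedGaloisRep.IsOrdinaryOfWeightAt p ρ v 2 m` (ordinary of WEIGHT TWO,
Hodge–Tate weights `{0,1}`: the Tate modules of ordinary abelian varieties) plus potentially crystalline.
* `θ = 0`: weight `k = 2` — FLOOR, in the tree (`floor_zero`, binders verbatim, the fact's extra
  `T.IsRegular` conjunct dropped from the conclusion).
* `θ ≥ 1`: ANY weight `k ≥ 2` (`IsOrdinaryOfWeightAt p ρ v k m`: `ρ|I_v ∼ (χ_p^{k-1}·finite ∗ ; 0 finite)`),
  every other binder unchanged (every `p`, every `ρ̄`, `F` totally real, `ρ` irreducible, a.e. unramified,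
  totally odd, potentially crystalline above `p`) — THE RUNG
  `OrdinaryPotentialAutomorphyEveryWeight = OrdinaryPotentialAutomorphy 1` — OPEN.  Located stop, in
  print: Thorne 2026 p. 2 "[SW99] … gives generally applicable results only in the case `F = ℚ`, via a
  method that has so far resisted generalisation to the case of a general totally real field"; Skinner–Wiles
  1999 p. 8 "We need to be able to make large solvable extensions of `F(χ)` … such that the relative class
  number is controlled. When `F(χ)` is abelian over `ℚ` we can do this using a theorem of Washington …
  In the general case such a result is not known"; and Thorne's own method is tied to weight `{0,1}` at
  both ends — Thm. 3.2 (2) (local approximation mod `p^C` by ORDINARY ABELIAN VARIETIES, "we must construct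
  abelian varieties over completions `F_v` whose Tate modules approximate `ρ|G_{F_v}`", p. 3) and §4
  (depth-`C` lifting on the deformation ring "crystalline with Hodge–Tate weights in `[0,1]`", weight-0
  quaternionic forms).  Open core of the rung: `ρ̄` reducible with `F(χ̄)/ℚ` non-abelian (or `p = 2`) and
  `k > 2` — no modularity or potential-modularity theorem in print (Zhang 2024/2025 and the `p = 3`
  Fontaine–Mazur paper reach only ABELIAN totally real `F` with `p` split).

LINE SHAPE (four registered stubs, composition sorry-free, §7):
`stub_rung : OrdinaryPotentialAutomorphyEveryWeight` (the cap-lifting input) →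
`stub_descent : OrdinaryPotentialAutomorphyEveryWeight → AutomorphyOnSector` (potential ⇒ actual automorphy
over `F`, every `ι`: non-solvable descent + `ι`-transport — honest, itself open in general) →
`stub_sectorMerge : AutomorphyOnSector → SectorGaloisToAutomorphic` (a.e. Satake ⇒ clause (B) verbatim on the
sector, every `Rec`) → `stub_offSector : OffSectorReciprocity` (E off the sector) →
`ReciprocityUpToIrreducibility_of … : E` BY NAME.  §8: `E → every cell` and `Langlands → every cell`
(sorry-free; the on-path lemma `OrdinaryPotentialAutomorphyEveryWeight_of_Langlands`, with `F' := F`).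
-/

noncomputable section

set_option linter.dupNamespace false

open scoped MatrixGroups Matrix NumberField Classical
open NumberField IsDedekindDomain Field Filter
open Literature.NumberTheory.Automorphic Literature.NumberTheory.GaloisRepresentations
open Literature.NumberTheory.PAdicHodge
open Summit.Langlands

namespace Summit.Langlands.Langlands.Cruxes.ReciprocityUpToIrreducibility.OrdinaryPotentialAutomorphyEveryWeight

/-! ## 1. The dial clause -/

/-- The **weight clause** of the dial (the ONE hypothesis that moves): `θ = 0` — the weight is `2`
(Thorne 2026 Thm. B verbatim, the tree's fact); `θ ≥ 1` — any weight `k ≥ 2`. -/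
def weightClause : ℕ → ℕ → Prop
  | 0, k => k = 2
  | _ + 1, k => 2 ≤ k

theorem weightClause_zero_iff (k : ℕ) : weightClause 0 k ↔ k = 2 := Iff.rfl

theorem weightClause_succ_iff (θ k : ℕ) : weightClause (θ + 1) k ↔ 2 ≤ k := Iff.rfl

/-- The clause only weakens as `θ` grows. -/
theorem weightClause_mono {θ θ' : ℕ} (hle : θ ≤ θ') {k : ℕ} (h : weightClause θ k) :
    weightClause θ' k := by
  cases θ' with
  | zero =>
    have : θ = 0 := Nat.le_zero.mp hle
    subst this; exact h
  | succ j =>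
    cases θ with
    | zero =>
      have hk : k = 2 := h
      show 2 ≤ k
      omega
    | succ i => exact h

/-! ## 2. The hypotheses, the conclusion, the family, the rung -/

/-- **Local hypothesis above `p`** (verbatim from the fact, with the weight `2` replaced by `k`): at every
`v ∣ p`, `ρ|Γ_{F_v}` is ORDINARY OF WEIGHT `k` (`ρ|I_v ∼ (θ₁ ∗ ; 0 θ₂)`, `θ₁^m = χ_p^{(k-1)m}`, `θ₂^m = 1`)
for some `m > 0`, de Rham for the PINNED Fontaine datum, and potentially crystalline (`N = 0`). -/
def OrdinaryLocalHyp (F : Type) [Field F] [NumberField F] (p : ℕ) [Fact p.Prime]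
    (ρ : FramedGaloisRep F (PadicAlgCl p) 2) (k : ℕ) : Prop :=
  ∀ (v : HeightOneSpectrum (𝓞 F)) (hv : ((p : ℕ) : 𝓞 F) ∈ v.asIdeal),
    ∃ m : ℕ, 0 < m ∧ FramedGaloisRep.IsOrdinaryOfWeightAt p ρ v k m ∧
      (fontainePstAdicCompletion v p hv).IsDeRhamFramed (ρ.toLocal v) ∧
      ∀ r, (fontainePstAdicCompletion v p hv).IsWeilDeligneOf (ρ.toLocal v) r → r.N = 0

/-- **Conclusion shape** (verbatim from the fact, minus its `T.IsRegular` conjunct): `ρ` is POTENTIALLY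
automorphic — a finite totally real `F'/F`, an `ι : ℚ̄_p ≃ ℂ`, and for every admissible level structure a
cuspidal `L`-algebraic `π` of `GL₂(𝔸_{F'})` with `char ρ|_{Γ_{F'}}(Frob_w) =` the Satake polynomial of `π_w`
at almost every `w` (the summit's normalisation `m = 1`). -/
def PotentiallyAutomorphicAE (F : Type) [Field F] [NumberField F] (p : ℕ) [Fact p.Prime]
    (ρ : FramedGaloisRep F (PadicAlgCl p) 2) : Prop :=
  ∃ (F' : Type) (_ : Field F') (_ : NumberField F') (_ : Algebra F F'),
    IsTotallyReal F' ∧ ∃ ι : PadicAlgCl p ≃+* ℂ,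
      ∀ hF' : isCompact_glFiniteIntegralLevel 2 F',
        ∃ π : CuspidalAutomorphicRepData 2 F' hF', π.1.IsLAlgebraic ∧
          SatakeFrobCompatibleAE ι π.1 (ρ.restrictField F')

/-- **The rung family** `E(θ)`: residually-unrestricted potential automorphy for `GL₂` over totally real
`F`, every prime `p`, for irreducible, a.e.-unramified, totally odd `ρ`, ordinary of weight `k` and
potentially crystalline above `p`, with `weightClause θ k`.
`θ = 0` IN THE TREE (Thorne 2026 Thm. B); `θ ≥ 1` OPEN.
[cite: arXiv:2608.07186, Thm. B, Thm. 3.2, Thm. 4.1] [cite: SkinnerWiles1999, Thm. A/B §4.5, p. 8] -/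
def OrdinaryPotentialAutomorphy (θ : ℕ) : Prop :=
  ∀ (F : Type) [Field F] [NumberField F], IsTotallyReal F →
    ∀ (p : ℕ) [Fact p.Prime] (ρ : FramedGaloisRep F (PadicAlgCl p) 2) (k : ℕ),
      weightClause θ k →
      ρ.toGaloisRep.IsIrreducible →
      (∀ᶠ v : HeightOneSpectrum (𝓞 F) in cofinite, ρ.IsUnramifiedAt v) →
      OrdinaryLocalHyp F p ρ k → ρ.IsOdd →
      PotentiallyAutomorphicAE F p ρ

/-- **THE RUNG** (the filed statement): the family at `θ = 1` — Thorne's residually-unrestricted ordinary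
potential automorphy over totally real fields in EVERY weight `k ≥ 2`.  OPEN. -/
def OrdinaryPotentialAutomorphyEveryWeight : Prop := OrdinaryPotentialAutomorphy 1

theorem rung_iff_family_one :
    OrdinaryPotentialAutomorphyEveryWeight ↔ OrdinaryPotentialAutomorphy 1 := Iff.rfl

/-! ## 3. (F2) Monotonicity: a higher cell implies every lower cell -/

theorem mono {θ θ' : ℕ} (hle : θ ≤ θ') (h : OrdinaryPotentialAutomorphy θ') :
    OrdinaryPotentialAutomorphy θ := by
  intro F _ _ hF p _ ρ k hk
  exact h F hF p ρ k (weightClause_mono hle hk)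

/-- Every cell `θ ≥ 1` is the rung (the dial is constant from `θ = 1` on). -/
theorem family_succ_iff (θ : ℕ) :
    OrdinaryPotentialAutomorphy (θ + 1) ↔ OrdinaryPotentialAutomorphyEveryWeight := by
  constructor
  · exact fun h => mono (by omega) h
  · intro h F _ _ hF p _ ρ k hk
    exact h F hF p ρ k hk

theorem floor_of_rung (h : OrdinaryPotentialAutomorphyEveryWeight) : OrdinaryPotentialAutomorphy 0 :=
  mono (by omega) h

/-! ## 4. (F3) Floor: `θ = 0` is the tree's named fact (Thorne 2026, Theorem B) -/

/-- **FLOOR** `θ = 0` from the named fact (binders verbatim; the fact's conclusion also records a regular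
infinity type, which the family's conclusion does not ask for). -/
theorem floor_zero (hT : Thorne2026_potentialAutomorphy_GL2_potCrystallineOrdinary) :
    OrdinaryPotentialAutomorphy 0 := by
  intro F _ _ hF p _ ρ k hk hirr hunr hloc hodd
  have hk2 : k = 2 := hk
  subst hk2
  obtain ⟨F', i1, i2, i3, hF', ι, hall⟩ := hT F hF p ρ hirr hunr hloc hodd
  refine ⟨F', i1, i2, i3, hF', ι, fun hcpt => ?_⟩
  obtain ⟨π, hL, -, hS⟩ := hall hcpt
  exact ⟨π, hL, hS⟩

/-- F3 witness shape: the floor cell by `simpa` from the floor lemma. -/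
example (h : Thorne2026_potentialAutomorphy_GL2_potCrystallineOrdinary) : OrdinaryPotentialAutomorphy 0 := by
  simpa using floor_zero h

/-! ## 5. The sector of clause (B) carried by the rung, the intermediate targets, the complement -/

/-- **The ordinary totally-odd sector of clause (B)** at `(F, p, ρ)` for `n = 2`: exactly the rung's
hypotheses beyond those clause (B) brings itself (irreducible, geometric) — `F` totally real, `ρ` totally
odd, ordinary of some weight `k ≥ 2` and potentially crystalline above `p`. -/
def InOrdinarySector (F : Type) [Field F] [NumberField F] (p : ℕ) [Fact p.Prime]
    (ρ : FramedGaloisRep F (PadicAlgCl p) 2) : Prop :=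
  IsTotallyReal F ∧ ρ.IsOdd ∧ ∃ k : ℕ, 2 ≤ k ∧ OrdinaryLocalHyp F p ρ k

/-- **Descent target**: ACTUAL automorphy over `F` (a.e. Satake, every `ι`, every admissible level
structure) on the sector. -/
def AutomorphyOnSector : Prop :=
  ∀ (F : Type) [Field F] [NumberField F] (hcpt : isCompact_glFiniteIntegralLevel 2 F)
    (p : ℕ) [Fact p.Prime] (ι : PadicAlgCl p ≃+* ℂ) (ρ : FramedGaloisRep F (PadicAlgCl p) 2),
    ρ.toGaloisRep.IsIrreducible →
    (∀ᶠ v : HeightOneSpectrum (𝓞 F) in cofinite, ρ.IsUnramifiedAt v) →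
    InOrdinarySector F p ρ →
      ∃ π : CuspidalAutomorphicRepData 2 F hcpt, π.1.IsLAlgebraic ∧ SatakeFrobCompatibleAE ι π.1 ρ

/-- **Merge target**: clause (B) of E VERBATIM (cuspidal, `L`-algebraic, `Corresponds Rec ι π ρ` — a.e.
Satake AND local–global compatibility at every finite place, at `v ∣ p` against `Rec.pst`) for EVERY
reciprocity datum `Rec`, on the sector. -/
def SectorGaloisToAutomorphic : Prop :=
  ∀ (F : Type) [Field F] [NumberField F] (Rec : ReciprocityData F)
    (hcpt : isCompact_glFiniteIntegralLevel 2 F) (p : ℕ) [Fact p.Prime] (ι : PadicAlgCl p ≃+* ℂ)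
    (ρ : FramedGaloisRep F (PadicAlgCl p) 2),
    ρ.toGaloisRep.IsIrreducible → IsGeometricFramed Rec ρ → InOrdinarySector F p ρ →
      ∃ π : CuspidalAutomorphicRepData 2 F hcpt, π.1.IsLAlgebraic ∧ Corresponds Rec ι π.1 ρ

/-- **The off-sector complement**: E with clause (A′) entire, clause (B) entire for `n ≠ 2`, and clause
(B) for `n = 2` restricted to `ρ` NOT in the ordinary totally-odd sector. -/
def OffSectorReciprocity : Prop :=
  ∀ (F : Type) [Field F] [NumberField F], ∃ Rec : ReciprocityData F,
    (∀ n : ℕ, 0 < n → ∀ hcpt : isCompact_glFiniteIntegralLevel n F,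
      ∀ π : CuspidalAutomorphicRepData n F hcpt, π.1.IsLAlgebraic →
        ∀ (ℓ : ℕ) [Fact ℓ.Prime] (ι : PadicAlgCl ℓ ≃+* ℂ),
          ∃ ρ : FramedGaloisRep F (PadicAlgCl ℓ) n, IsGeometricFramed Rec ρ ∧ Corresponds Rec ι π.1 ρ) ∧
    (∀ n : ℕ, 0 < n → n ≠ 2 → ∀ hcpt : isCompact_glFiniteIntegralLevel n F, GaloisToAutomorphic n Rec hcpt) ∧
    (∀ (hcpt : isCompact_glFiniteIntegralLevel 2 F) (ℓ : ℕ) [Fact ℓ.Prime] (ι : PadicAlgCl ℓ ≃+* ℂ)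
      (ρ : FramedGaloisRep F (PadicAlgCl ℓ) 2),
      ρ.toGaloisRep.IsIrreducible → IsGeometricFramed Rec ρ → ¬ InOrdinarySector F ℓ ρ →
        ∃ π : CuspidalAutomorphicRepData 2 F hcpt, π.1.IsLAlgebraic ∧ Corresponds Rec ι π.1 ρ)

/-! ## 6. The four registered stubs -/

/-- **THE RUNG / cap-lifting input**: Thorne's residually-unrestricted ordinary potential automorphy over
totally real fields in every weight `k ≥ 2`.  OPEN: in weight `k > 2` with `ρ̄` reducible and `F(χ̄)/ℚ`
non-abelian (or `p = 2`) no modularity or potential-modularity theorem is in print — Skinner–Wiles 1999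
needs Washington's theorem on class numbers in `ℤ_ℓ`-extensions (abelian `F(χ)` only), Pan / Zhang need
`F` abelian with `p` split and the `p`-adic local Langlands correspondence for `GL₂(ℚ_p)`, and Thorne's
depth-`C` method approximates `ρ|Γ_{F_v}` modulo `p^C` by Tate modules of ordinary abelian varieties and
patches on the Hodge–Tate-`[0,1]` crystalline deformation ring.  The line's bet: a depth-`C` lifting
theorem on Hida's universal ordinary Hecke algebra (all weights at once), with the weight-`2` members of the
Hida family through `ρ` as the approximants. -/
theorem stub_rung : OrdinaryPotentialAutomorphyEveryWeight := by
  sorry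

/-- **Descent**: from potential automorphy over some totally real `F'/F` for one `ι` to automorphy over
`F` for every `ι` on the sector (non-solvable descent of automorphy along `F'/F` — open in general, solvable
case by Langlands–Arthur–Clozel cyclic descent; `ι`-transport through the compatible system of the
descended Hilbert modular form). -/
theorem stub_descent : OrdinaryPotentialAutomorphyEveryWeight → AutomorphyOnSector := by
  sorry

/-- **Sector merge**: from a.e.-Satake automorphy over `F` to clause (B) of E verbatim on
`InOrdinarySector`, for every `Rec`: cuspidality and `L`-algebraicity kept, local–global compatibility at
EVERY finite place (at `v ∤ p`: Carayol / Blasius–Rogawski–Taylor for Hilbert modular forms; at `v ∣ p`: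
de Rham for the pinned datum by hypothesis, Saito / Skinner / Liu for `r_ι(π)`), strong multiplicity one. -/
theorem stub_sectorMerge : AutomorphyOnSector → SectorGaloisToAutomorphic := by
  sorry

/-- The honest complement: E off the sector. -/
theorem stub_offSector : OffSectorReciprocity := by
  sorry

/-! ## 7. Composition (no sorry below this line) -/

/-- **THE REGISTERED SKELETON THEOREM** — the item's decl from the four registered stubs BY NAME (audit:
proof-of-item modulo the four sorries).  `Rec`, clause (A′), clause (B) for `n ≠ 2` and clause (B) off the
sector come from `stub_offSector`; for `n = 2` on the sector the RUNG `stub_rung` is descended by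
`stub_descent` and merged by `stub_sectorMerge`. -/
theorem ReciprocityUpToIrreducibility_proof :
    Summit.Langlands.Langlands.Theses.OrdinaryPrimeTransport.ReciprocityUpToIrreducibility := by
  intro F _ _
  obtain ⟨Rec, hA, hBne, hBoff⟩ := stub_offSector F
  refine ⟨Rec, fun n hn hcpt => ⟨hA n hn hcpt, ?_⟩⟩
  intro ℓ _ ι ρ hirr hgeo
  by_cases hn2 : n = 2
  · subst hn2
    by_cases hsec : InOrdinarySector F ℓ ρ
    · exact stub_sectorMerge (stub_descent stub_rung) F Rec hcpt ℓ ι ρ hirr hgeo hsec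
    · exact hBoff hcpt ℓ ι ρ hirr hgeo hsec
  · exact hBne n hn hn2 hcpt ℓ ι ρ hirr hgeo

/-- The TOP, under a reducible alias (so that exactly ONE theorem of this file — the registered
`ReciprocityUpToIrreducibility_proof` above — concludes the item's decl syntactically). -/
abbrev TopCrux : Prop :=
  Summit.Langlands.Langlands.Theses.OrdinaryPrimeTransport.ReciprocityUpToIrreducibility

example : TopCrux = Summit.Langlands.Langlands.Theses.OrdinaryPrimeTransport.ReciprocityUpToIrreducibility :=
  rfl

/-- **COMPOSITION (hypothesis form)** — the crux from the four stub STATEMENTS, kernel-checked, no sorry: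
`stub_rung-sig → stub_descent-sig → stub_sectorMerge-sig → stub_offSector-sig → crux` (`TopCrux` unfolds to
the item's decl by `rfl`). -/
theorem ReciprocityUpToIrreducibility_of :
    OrdinaryPotentialAutomorphyEveryWeight →
    (OrdinaryPotentialAutomorphyEveryWeight → AutomorphyOnSector) →
    (AutomorphyOnSector → SectorGaloisToAutomorphic) →
    OffSectorReciprocity → TopCrux := by
  intro hrung hdesc hmerge hoff F _ _
  obtain ⟨Rec, hA, hBne, hBoff⟩ := hoff F
  refine ⟨Rec, fun n hn hcpt => ⟨hA n hn hcpt, ?_⟩⟩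
  intro ℓ _ ι ρ hirr hgeo
  by_cases hn2 : n = 2
  · subst hn2
    by_cases hsec : InOrdinarySector F ℓ ρ
    · exact hmerge (hdesc hrung) F Rec hcpt ℓ ι ρ hirr hgeo hsec
    · exact hBoff hcpt ℓ ι ρ hirr hgeo hsec
  · exact hBne n hn hn2 hcpt ℓ ι ρ hirr hgeo

/-- The rung from the registered stubs (it is load-bearing: `ReciprocityUpToIrreducibility_of` passes it
through the descent to the merge). -/
theorem rung_of_stubs : OrdinaryPotentialAutomorphyEveryWeight := stub_rung

#print axioms ReciprocityUpToIrreducibility_of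

/-! ## 8. The rung is a consequence of the top and of the summit (sorry-free) -/

/-- Packaging automorphy over `F` itself as POTENTIAL automorphy with `F' := F` (restriction along
`Algebra.id` is an inner automorphism of `Γ_F`, and a.e.-Satake compatibility is conjugation-invariant). -/
theorem potentiallyAutomorphicAE_of_self {F : Type} [Field F] [NumberField F] (hF : IsTotallyReal F)
    {p : ℕ} [Fact p.Prime] (ρ : FramedGaloisRep F (PadicAlgCl p) 2) (ι : PadicAlgCl p ≃+* ℂ)
    (h : ∀ hF' : isCompact_glFiniteIntegralLevel 2 F,
      ∃ π : CuspidalAutomorphicRepData 2 F hF', π.1.IsLAlgebraic ∧ SatakeFrobCompatibleAE ι π.1 ρ) :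
    PotentiallyAutomorphicAE F p ρ := by
  -- `res : Γ_F → Γ_F` along `Algebra.id` is conjugation by some `τ`
  obtain ⟨τ, hτ⟩ := absGaloisRestrict_isConj_of_algHom_holds F F (AlgHom.id F (AlgebraicClosure F))
    id (fun σ x => rfl)
  refine ⟨F, inferInstance, inferInstance, inferInstance, hF, ι, fun hF' => ?_⟩
  obtain ⟨π, hL, hc⟩ := h hF'
  refine ⟨π, hL, ?_⟩
  have e : ρ.restrictField F = FramedRep.conj (ρ τ)⁻¹ ρ := by
    refine ContinuousMonoidHom.ext fun σ => ?_
    have h1 : absGaloisRestrict F F σ = τ⁻¹ * σ * τ :=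
      calc absGaloisRestrict F F σ = τ⁻¹ * (τ * absGaloisRestrict F F σ * τ⁻¹) * τ := by group
        _ = τ⁻¹ * σ * τ := by rw [← hτ σ]; rfl
    rw [FramedGaloisRep.restrictField_apply, FramedRep.conj_apply, h1, map_mul, map_mul, map_inv,
      inv_inv]
  rw [e, satakeFrobCompatibleAE_conj_iff]
  exact hc

/-- Clause (B) at SOME datum for every `F` (and `n = 2`) gives every cell: the local clause of the cell is
stated against the PINNED Fontaine datum `fontainePstAdicCompletion v p hv = Rec.pst p v hv` (`rfl`), so
`IsGeometricFramed Rec ρ`; `Corresponds Rec ι π ρ` contains a.e. Satake–Frobenius matching; an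
`ι : ℚ̄_p ≃ ℂ` exists (Steinitz); then `F' := F`. -/
theorem family_of_clauseB (θ : ℕ)
    (hB : ∀ (F : Type) [Field F] [NumberField F], ∃ Rec : ReciprocityData F,
      ∀ hcpt : isCompact_glFiniteIntegralLevel 2 F, GaloisToAutomorphic 2 Rec hcpt) :
    OrdinaryPotentialAutomorphy θ := by
  intro F _ _ hF p _ ρ k _hk hirr hunr hloc _hodd
  obtain ⟨Rec, hall⟩ := hB F
  have hdR : ∀ (v : HeightOneSpectrum (𝓞 F)) (hv : ((p : ℕ) : 𝓞 F) ∈ v.asIdeal),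
      (Rec.pst p v hv).IsDeRhamFramed (ρ.toLocal v) := by
    intro v hv
    change (fontainePstAdicCompletion v p hv).IsDeRhamFramed (ρ.toLocal v)
    obtain ⟨m, -, -, hdr, -⟩ := hloc v hv
    exact hdr
  have hgeo : IsGeometricFramed Rec ρ := ⟨hunr, hdR⟩
  obtain ⟨ι⟩ := PadicAlgCl.nonempty_ringEquiv_complex p
  refine potentiallyAutomorphicAE_of_self hF ρ ι fun hcpt => ?_
  obtain ⟨π, hπL, hcorr⟩ := hall hcpt p ι ρ hirr hgeo
  exact ⟨π, hπL, hcorr.1⟩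

/-- `E → every cell`. -/
theorem family_of_top (θ : ℕ)
    (hE : Summit.Langlands.Langlands.Theses.OrdinaryPrimeTransport.ReciprocityUpToIrreducibility) :
    OrdinaryPotentialAutomorphy θ :=
  family_of_clauseB θ fun F _ _ => by
    obtain ⟨Rec, hall⟩ := hE F
    exact ⟨Rec, fun hcpt => (hall 2 two_pos hcpt).2⟩

/-- `E → rung`. -/
theorem OrdinaryPotentialAutomorphyEveryWeight_of_top
    (hE : Summit.Langlands.Langlands.Theses.OrdinaryPrimeTransport.ReciprocityUpToIrreducibility) :
    OrdinaryPotentialAutomorphyEveryWeight :=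
  family_of_top 1 hE

/-- `Langlands → every cell`. -/
theorem family_of_langlands (θ : ℕ) (hL : _root_.Langlands) : OrdinaryPotentialAutomorphy θ :=
  family_of_clauseB θ fun F _ _ => by
    obtain ⟨⟨Rec⟩, hall⟩ := hL F
    exact ⟨Rec, fun hcpt => (hall Rec 2 two_pos hcpt).2⟩

/-- **F4 on-path lemma for the rung**: `Langlands → OrdinaryPotentialAutomorphyEveryWeight`. -/
@[aesop safe apply]
theorem OrdinaryPotentialAutomorphyEveryWeight_of_Langlands (hL : _root_.Langlands) :
    OrdinaryPotentialAutomorphyEveryWeight :=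
  family_of_langlands 1 hL

example : _root_.Langlands → OrdinaryPotentialAutomorphyEveryWeight := by intro h; aesop

end Summit.Langlands.Langlands.Cruxes.ReciprocityUpToIrreducibility.OrdinaryPotentialAutomorphyEveryWeight

end
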